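import Literature.NumberTheory.NumberFields.CMFieldAmbiguousClassNumber
import Mathlib.NumberTheory.NumberField.CMField
import HarnessLib

/-!
# Okazaki's Lemma 17 with the UNIT hypothesis displayed, and its transport along field isomorphisms:
# `h(K⁺)` odd ∧ every totally positive unit of `K⁺` a square ⟹ `#Cl_K[2] = 2^{t−1}`

Topic `NumberTheory/NumberFields` (namespace = path).  THEOREM-ONLY file (no definition, no named fact, no instance, no `sorry`),
written by the prover seat `bsd-2adic-conv-1` GEN 33 (cell `bsd-2adic`; pen RC-450 key «FW-IQ-GENUS»).  Companion of
`CMFieldAmbiguousClassNumber.lean` (Okazaki 2000 Lemma 17 under «`h⁺(K⁺)` odd») and `HasseUnitIndexOddNarrowClassNumber.lean`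
(«`h⁺(K⁺)` odd ⟹ totally positive units of `K⁺` are squares»).  WHY: in the genus-theory computation of the `2`-class groups
of the layers `K·ℚ_n` of the cyclotomic `ℤ₂`-extension of an imaginary quadratic field `K`, the hypothesis on the maximal real
subfield `(K·ℚ_n)⁺ ≅ ℚ_n ≅ ℚ(ζ_{2^{n+2}})⁺` arrives through a FIELD ISOMORPHISM from the cyclotomic side; the two hypotheses
«`h` odd» and «totally positive units are squares» transport along ring isomorphisms by three-line arguments (§2), whereas
the narrow class number itself would need the narrow class group.  So Lemma 17 is re-keyed on exactly those two hypotheses.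

* §1 `IsCMField.relIndex_sq_unitsNorm_eq_one_of_forall_isSquare` (`Q̃_K = 1`: a unit of `K⁺` that is a norm from `Kˣ` is totally
  positive, hence a square), **`IsCMField.card_twoTorsion_classGroup_eq_two_pow_of_odd_of_forall_isSquare`**
  (`#Cl_K[2] = 2^{t−1}`, with `t ≥ 1`: `IsCMField.one_le_card_ramified_of_odd_of_forall_isSquare`).
* §2 transport along `e : F ≃+* F'`: `odd_classNumber_of_ringEquiv`, `forall_isSquare_of_totallyPositive_of_ringEquiv`,
  `natCard_twoTorsion_classGroup_eq_of_ringEquiv`.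

References: [Okazaki2000] §3 Lemma 17 (and Lemma 15); [Horie1994] §1 Lemma 1; [Washington1997] Thm. 10.1 / §13.
-/

set_option autoImplicit false

noncomputable section

open NumberField NumberField.IsCMField IsDedekindDomain Module

namespace Literature.NumberTheory.NumberFields

open Literature.NumberTheory.GaloisRepresentations Literature.NumberTheory.GaloisRepresentations.Herbrand
  Literature.NumberTheory.GaloisRepresentations.MinkowskiUnit
  Literature.NumberTheory.GaloisRepresentations.CyclicNormIndex

/-! ## §1 Okazaki's Lemma 17 keyed on «`h(K⁺)` odd, totally positive units of `K⁺` are squares» -/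

section Okazaki

variable (K : Type) [Field K] [NumberField K] [IsCMField K]

/-- **`Q̃_K = 1` when every totally positive unit of `K⁺` is a square**: a unit of `K⁺` which is a norm from `Kˣ` is totally
positive (`IsCMField.embedding_pos_of_unitsIncl_eq_norm`), hence a square; so `E ∩ N Kˣ = E²`.
[cite: Okazaki2000, §3 Lemma 17 (proof: «the quotient of indices is 1») and Lemma 15] -/
theorem IsCMField.relIndex_sq_unitsNorm_eq_one_of_forall_isSquare
    (hsq : ∀ u : (𝓞 (maximalRealSubfield K))ˣ,
      (∀ σ : maximalRealSubfield K →+* ℝ, 0 < σ ((u : 𝓞 (maximalRealSubfield K)) : maximalRealSubfield K)) → IsSquare u) :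
    ((powMonoidHom 2 : (𝓞 (maximalRealSubfield K))ˣ →* (𝓞 (maximalRealSubfield K))ˣ).range).relIndex
        (((⊤ : Subgroup Kˣ).map (Herbrand.norm (K ≃ₐ[maximalRealSubfield K] K))).comap
          ((unitsIncl (maximalRealSubfield K) K).comp
            (Units.map (algebraMap (𝓞 (maximalRealSubfield K)) (maximalRealSubfield K) :
              𝓞 (maximalRealSubfield K) →* maximalRealSubfield K)))) = 1 := by
  set j := (unitsIncl (maximalRealSubfield K) K).comp
    (Units.map (algebraMap (𝓞 (maximalRealSubfield K)) (maximalRealSubfield K) :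
      𝓞 (maximalRealSubfield K) →* maximalRealSubfield K)) with hj
  rw [Subgroup.relIndex_eq_one]
  intro v hv
  obtain ⟨y, -, hy⟩ := Subgroup.mem_map.mp (Subgroup.mem_comap.mp hv)
  have hpos : ∀ σ : maximalRealSubfield K →+* ℝ,
      0 < σ ((v : 𝓞 (maximalRealSubfield K)) : maximalRealSubfield K) := fun σ => by
    have h := IsCMField.embedding_pos_of_unitsIncl_eq_norm K
      (c := Units.map (algebraMap (𝓞 (maximalRealSubfield K)) (maximalRealSubfield K) :
        𝓞 (maximalRealSubfield K) →* maximalRealSubfield K) v) (y := y)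
      (by rw [hy, hj, MonoidHom.comp_apply]) σ
    simpa only [Units.coe_map, MonoidHom.coe_coe] using h
  obtain ⟨ε, hε⟩ := hsq v hpos
  exact ⟨ε, by rw [powMonoidHom_apply, pow_two, hε]⟩

/-- **`t ≥ 1` under the two hypotheses**: `#Cl_K[2] · 2 = 2^t · Q̃_K = 2^t` forces `t ≠ 0`. [cite: Okazaki2000, §3 Lemma 17] -/
theorem IsCMField.one_le_card_ramified_of_odd_of_forall_isSquare
    (hodd : Odd (classNumber (maximalRealSubfield K)))
    (hsq : ∀ u : (𝓞 (maximalRealSubfield K))ˣ,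
      (∀ σ : maximalRealSubfield K →+* ℝ, 0 < σ ((u : 𝓞 (maximalRealSubfield K)) : maximalRealSubfield K)) → IsSquare u) :
    1 ≤ {v : HeightOneSpectrum (𝓞 (maximalRealSubfield K)) | v.asIdeal.ramificationIdxIn (𝓞 K) ≠ 1}.ncard := by
  have h := IsCMField.card_twoTorsion_classGroup_mul_two_eq_of_odd K hodd
  rw [IsCMField.relIndex_sq_unitsNorm_eq_one_of_forall_isSquare K hsq, mul_one] at h
  by_contra h0
  have ht : {v : HeightOneSpectrum (𝓞 (maximalRealSubfield K)) |
      v.asIdeal.ramificationIdxIn (𝓞 K) ≠ 1}.ncard = 0 := by omega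
  rw [ht, pow_zero] at h
  have hpos : 0 < Nat.card {c : ClassGroup (𝓞 K) // c ^ 2 = 1} := by
    haveI : Finite {c : ClassGroup (𝓞 K) // c ^ 2 = 1} := inferInstance
    haveI : Nonempty {c : ClassGroup (𝓞 K) // c ^ 2 = 1} := ⟨⟨1, one_pow 2⟩⟩
    exact Nat.card_pos
  omega

/-- **Okazaki's Lemma 17, keyed on the unit hypothesis: `h(K⁺)` odd and every totally positive unit of `K⁺` a square ⟹
`#Cl_K[2] = 2^{t−1}`**, `t` the number of finite primes of `K⁺` ramified in `K`.  (With «`h⁺(K⁺)` odd» in place of the two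
hypotheses this is `IsCMField.card_twoTorsion_classGroup_eq_two_pow_of_odd_narrowClassNumber`; the two hypotheses are exactly what
«`h⁺(K⁺)` odd» supplies, Okazaki Lemma 15 / Hasse.) [cite: Okazaki2000, §3 Lemma 17] [cite: Horie1994, §1 Lemma 1, (1.1)] -/
theorem IsCMField.card_twoTorsion_classGroup_eq_two_pow_of_odd_of_forall_isSquare
    (hodd : Odd (classNumber (maximalRealSubfield K)))
    (hsq : ∀ u : (𝓞 (maximalRealSubfield K))ˣ,
      (∀ σ : maximalRealSubfield K →+* ℝ, 0 < σ ((u : 𝓞 (maximalRealSubfield K)) : maximalRealSubfield K)) → IsSquare u) :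
    Nat.card {c : ClassGroup (𝓞 K) // c ^ 2 = 1} =
      2 ^ ({v : HeightOneSpectrum (𝓞 (maximalRealSubfield K)) | v.asIdeal.ramificationIdxIn (𝓞 K) ≠ 1}.ncard - 1) := by
  have h := IsCMField.card_twoTorsion_classGroup_mul_two_eq_of_odd K hodd
  rw [IsCMField.relIndex_sq_unitsNorm_eq_one_of_forall_isSquare K hsq, mul_one] at h
  have ht := IsCMField.one_le_card_ramified_of_odd_of_forall_isSquare K hodd hsq
  set t := {v : HeightOneSpectrum (𝓞 (maximalRealSubfield K)) | v.asIdeal.ramificationIdxIn (𝓞 K) ≠ 1}.ncard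
  have hpow : 2 ^ t = 2 ^ (t - 1) * 2 := by
    rw [← pow_succ, Nat.sub_one_add_one_eq_of_pos ht]
  rw [hpow] at h
  exact Nat.eq_of_mul_eq_mul_right two_pos h

end Okazaki

/-! ## §2 Transport along isomorphisms of number fields -/

section Transport

variable {F F' : Type*} [Field F] [NumberField F] [Field F'] [NumberField F']

/-- **The class number is an isomorphism invariant** (`Cl(𝓞 F) ≅ Cl(𝓞 F')` along `𝓞 F ≅ 𝓞 F'`). [cite: Washington1997, §13 (proof of Prop. 13.22)] -/
theorem classNumber_eq_of_ringEquiv (e : F ≃+* F') : classNumber F = classNumber F' :=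
  Fintype.card_congr (ClassGroup.mulEquiv (RingOfIntegers.mapRingEquiv e)).toEquiv

/-- Oddness of the class number transports along a field isomorphism. [cite: Washington1997, §13 (proof of Prop. 13.22)] -/
theorem odd_classNumber_of_ringEquiv (e : F ≃+* F') (h : Odd (classNumber F)) : Odd (classNumber F') := by
  rwa [← classNumber_eq_of_ringEquiv e]

omit [NumberField F] [NumberField F'] in
/-- **The number of `2`-torsion ideal classes is an isomorphism invariant.** [cite: Washington1997, §13 (proof of Prop. 13.22)] -/
theorem natCard_twoTorsion_classGroup_eq_of_ringEquiv (e : F ≃+* F') :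
    Nat.card {c : ClassGroup (𝓞 F) // c ^ 2 = 1} = Nat.card {c : ClassGroup (𝓞 F') // c ^ 2 = 1} := by
  set φ := ClassGroup.mulEquiv (RingOfIntegers.mapRingEquiv e) with hφ
  refine Nat.card_congr (Equiv.subtypeEquiv φ.toEquiv fun c => ?_)
  change c ^ 2 = 1 ↔ φ c ^ 2 = 1
  rw [← map_pow, ← φ.map_one, φ.injective.eq_iff]

omit [NumberField F] [NumberField F'] in
/-- **«Every totally positive unit is a square» transports along a field isomorphism** `e : F ≃+* F'` (real embeddings of
`F` are the `σ' ∘ e`, units and squares correspond under `𝓞 F ≅ 𝓞 F'`). [cite: Okazaki2000, §3 Lemma 15] -/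
theorem forall_isSquare_of_totallyPositive_of_ringEquiv (e : F ≃+* F')
    (h : ∀ u : (𝓞 F)ˣ, (∀ σ : F →+* ℝ, 0 < σ ((u : 𝓞 F) : F)) → IsSquare u) :
    ∀ u : (𝓞 F')ˣ, (∀ σ : F' →+* ℝ, 0 < σ ((u : 𝓞 F') : F')) → IsSquare u := by
  intro u hu
  set g : 𝓞 F' ≃+* 𝓞 F := RingOfIntegers.mapRingEquiv e.symm with hg
  set u₀ : (𝓞 F)ˣ := Units.map g.toMonoidHom u with hu₀
  have hcoe : ((u₀ : 𝓞 F) : F) = e.symm ((u : 𝓞 F') : F') := by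
    rw [hu₀, Units.coe_map]
    rfl
  have hpos : ∀ σ : F →+* ℝ, 0 < σ ((u₀ : 𝓞 F) : F) := fun σ => by
    rw [hcoe]
    have := hu (σ.comp e.symm.toRingHom)
    simpa using this
  obtain ⟨ε, hε⟩ := h u₀ hpos
  refine ⟨Units.map g.symm.toMonoidHom ε, ?_⟩
  have hback : Units.map g.symm.toMonoidHom u₀ = u := by
    ext
    simp [hu₀]
  rw [← hback, hε, map_mul]

end Transport

end Literature.NumberTheory.NumberFields

end
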